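import Summits.AtomisticToContinuum.FouriersLaw.Theorems.HonestZwanzigNetworkReductionRobin

/-!
# `HonestZwanzig.RobinCoercivity` — the Robin incidence matrix on `Fin N ⊕ Fin 2`

Support file (`--supports` the crux `RobinCoercivity`, stmt-AtomisticToContinuum-12695, of route
`HonestZwanzig`, line LinAlg; stub `stub_robinIncidence` of the skeleton
`Cruxes/RobinCoercivity/Lines/LinAlg.lean`). Pure `Fin`-bookkeeping, no analysis.

The `(N+2) × N` Robin incidence matrix `B` of the path graph on `Fin N` with two contacts has its
rows indexed by `Fin N ⊕ Fin 2`: the bond rows `Sum.inl b` are the forward differences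
`(Bξ)_b = [b+1 < N](ξ_{b+1} − ξ_b)` (the row `b = N−1` vanishes: there is no bond there), and the two
contact rows `Sum.inr 0`, `Sum.inr 1` pick out `ξ_0` and `ξ_{N−1}`. Three identities:

1. `|Bξ|² = Σ_b (ξ_{b+1} − ξ_b)² + ξ_0² + ξ_{N−1}²`, the Robin quadratic form spelled EXACTLY as in
   the route decl `RobinCoercivity` (`robinIncidence_mulVec_dotProduct_self`);
2. `Bᵀ(ψ, φ)` is the discrete divergence
   `x ↦ Σ_{b+1<N} ([x = b+1] − [x = b]) ψ_b + [x = 0] φ_0 + [x = N−1] φ_1`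
   of a bond flux `ψ` and contact fluxes `φ` (`robinIncidence_transpose_mulVec`);
3. `|(ψ, φ)|² = Σ_b ψ_b² + φ_0² + φ_1²` (`robinIncidence_sumElim_dotProduct_self`).

They are bundled as `stub_robinIncidence`.
-/

noncomputable section

open Finset Matrix
open Summit.AtomisticToContinuum.FouriersLaw.Theorems.HonestZwanzig.NetworkReduction

namespace Summit.AtomisticToContinuum.FouriersLaw.Theorems.HonestZwanzig.Robin

variable {N : ℕ}

/-- A bond row of the Robin incidence matrix applied to a profile `ξ`: the forward difference
`(Bξ)_{inl b} = Σ_y [y = b+1] ξ_y − [b+1 < N] ξ_b` (the shifted value written as an indicator sum,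
`0` past the last site). [folklore] -/
theorem robinIncidence_mulVec_inl (B : Matrix (Fin N ⊕ Fin 2) (Fin N) ℝ)
    (hB : ∀ r x, B r x = Sum.elim
      (fun b : Fin N => if x.val = b.val + 1 then (1 : ℝ) else if x = b ∧ b.val + 1 < N then -1 else 0)
      (fun i : Fin 2 => if (i = 0 ∧ x.val = 0) ∨ (i = 1 ∧ x.val = N - 1) then (1 : ℝ) else 0) r)
    (ξ : Fin N → ℝ) (b : Fin N) :
    (B *ᵥ ξ) (Sum.inl b) =
      (∑ y : Fin N, if y.val = b.val + 1 then ξ y else 0) - (if b.val + 1 < N then ξ b else 0) := by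
  have hrow : (B *ᵥ ξ) (Sum.inl b) = ∑ x : Fin N, ((if x.val = b.val + 1 then ξ x else 0) -
      (if x = b ∧ b.val + 1 < N then ξ x else 0)) := by
    rw [Matrix.mulVec_apply_eq_sum]
    refine Finset.sum_congr rfl fun x _ => ?_
    rw [hB, Sum.elim_inl]
    by_cases h1 : x.val = b.val + 1
    · have h2 : ¬ (x = b ∧ b.val + 1 < N) := by
        rintro ⟨rfl, -⟩
        omega
      rw [if_pos h1, if_pos h1, if_neg h2]
      ring
    · rw [if_neg h1, if_neg h1]
      by_cases h2 : x = b ∧ b.val + 1 < N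
      · rw [if_pos h2, if_pos h2]
        ring
      · rw [if_neg h2, if_neg h2]
        ring
  rw [hrow, Finset.sum_sub_distrib]
  congr 1
  by_cases hb : b.val + 1 < N
  · rw [if_pos hb, Finset.sum_eq_single b]
    · rw [if_pos ⟨rfl, hb⟩]
    · intro x _ hxb
      rw [if_neg fun h => hxb h.1]
    · intro h
      exact absurd (Finset.mem_univ b) h
  · rw [if_neg hb]
    refine Finset.sum_eq_zero fun x _ => ?_
    rw [if_neg fun h => hb h.2]

/-- The left contact row of the Robin incidence matrix picks out `ξ_0` (`N ≥ 1`). [folklore] -/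
theorem robinIncidence_mulVec_inr_zero (h0 : 0 < N) (B : Matrix (Fin N ⊕ Fin 2) (Fin N) ℝ)
    (hB : ∀ r x, B r x = Sum.elim
      (fun b : Fin N => if x.val = b.val + 1 then (1 : ℝ) else if x = b ∧ b.val + 1 < N then -1 else 0)
      (fun i : Fin 2 => if (i = 0 ∧ x.val = 0) ∨ (i = 1 ∧ x.val = N - 1) then (1 : ℝ) else 0) r)
    (ξ : Fin N → ℝ) :
    (B *ᵥ ξ) (Sum.inr 0) = ξ ⟨0, h0⟩ := by
  have hrow : (B *ᵥ ξ) (Sum.inr 0) = ∑ x : Fin N, if x.val = 0 then ξ x else 0 := by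
    rw [Matrix.mulVec_apply_eq_sum]
    refine Finset.sum_congr rfl fun x _ => ?_
    rw [hB, Sum.elim_inr]
    by_cases hx : x.val = 0
    · rw [if_pos (Or.inl ⟨rfl, hx⟩), if_pos hx, one_mul]
    · rw [if_neg fun h => h.elim (fun h => hx h.2) (fun h => absurd h.1 (by decide)), if_neg hx,
        zero_mul]
  rw [hrow, sum_ite_val_eq 0 h0 ξ]

/-- The right contact row of the Robin incidence matrix picks out `ξ_{N−1}` (`N ≥ 1`). [folklore] -/
theorem robinIncidence_mulVec_inr_one (hN1 : N - 1 < N) (B : Matrix (Fin N ⊕ Fin 2) (Fin N) ℝ)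
    (hB : ∀ r x, B r x = Sum.elim
      (fun b : Fin N => if x.val = b.val + 1 then (1 : ℝ) else if x = b ∧ b.val + 1 < N then -1 else 0)
      (fun i : Fin 2 => if (i = 0 ∧ x.val = 0) ∨ (i = 1 ∧ x.val = N - 1) then (1 : ℝ) else 0) r)
    (ξ : Fin N → ℝ) :
    (B *ᵥ ξ) (Sum.inr 1) = ξ ⟨N - 1, hN1⟩ := by
  have hrow : (B *ᵥ ξ) (Sum.inr 1) = ∑ x : Fin N, if x.val = N - 1 then ξ x else 0 := by
    rw [Matrix.mulVec_apply_eq_sum]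
    refine Finset.sum_congr rfl fun x _ => ?_
    rw [hB, Sum.elim_inr]
    by_cases hx : x.val = N - 1
    · rw [if_pos (Or.inr ⟨rfl, hx⟩), if_pos hx, one_mul]
    · rw [if_neg fun h => h.elim (fun h => absurd h.1 (by decide)) (fun h => hx h.2), if_neg hx,
        zero_mul]
  rw [hrow, sum_ite_val_eq (N - 1) hN1 ξ]

/-- **Clause 1.** `|Bξ|²` is the Robin quadratic form of the route decl `RobinCoercivity`: for `N ≥ 2`,
`(Bξ)·(Bξ) = Σ_i (Σ_j [j = i+1] (ξ_j − ξ_i)² + [i = 0] ξ_i² + [i = N−1] ξ_i²)`. [folklore] -/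
theorem robinIncidence_mulVec_dotProduct_self (hN : 2 ≤ N) (B : Matrix (Fin N ⊕ Fin 2) (Fin N) ℝ)
    (hB : ∀ r x, B r x = Sum.elim
      (fun b : Fin N => if x.val = b.val + 1 then (1 : ℝ) else if x = b ∧ b.val + 1 < N then -1 else 0)
      (fun i : Fin 2 => if (i = 0 ∧ x.val = 0) ∨ (i = 1 ∧ x.val = N - 1) then (1 : ℝ) else 0) r)
    (ξ : Fin N → ℝ) :
    (B *ᵥ ξ) ⬝ᵥ (B *ᵥ ξ) =
      ∑ i : Fin N, ((∑ j : Fin N, if j.val = i.val + 1 then (ξ j - ξ i) ^ 2 else 0) +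
        (if i.val = 0 then ξ i ^ 2 else 0) + (if i.val = N - 1 then ξ i ^ 2 else 0)) := by
  have h0 : 0 < N := by omega
  have hN1 : N - 1 < N := by omega
  rw [dotProduct, Fintype.sum_sum_type, Fin.sum_univ_two,
    robinIncidence_mulVec_inr_zero h0 B hB ξ, robinIncidence_mulVec_inr_one hN1 B hB ξ,
    Finset.sum_add_distrib, Finset.sum_add_distrib, sum_ite_val_eq 0 h0 (fun i => ξ i ^ 2),
    sum_ite_val_eq (N - 1) hN1 (fun i => ξ i ^ 2)]
  -- the bond rows, squared
  have hb : ∀ b : Fin N, (B *ᵥ ξ) (Sum.inl b) * (B *ᵥ ξ) (Sum.inl b) =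
      ∑ j : Fin N, if j.val = b.val + 1 then (ξ j - ξ b) ^ 2 else 0 := by
    intro b
    rw [robinIncidence_mulVec_inl B hB ξ b]
    by_cases hb : b.val + 1 < N
    · rw [if_pos hb, sum_ite_succ_eq ξ b hb,
        sum_ite_val_eq (b.val + 1) hb (fun j => (ξ j - ξ b) ^ 2)]
      ring
    · rw [if_neg hb, sum_ite_succ_eq_zero ξ b hb, Finset.sum_eq_zero]
      · ring
      · intro j _
        rw [if_neg]
        intro h
        exact hb (h ▸ j.isLt)
  rw [Finset.sum_congr rfl fun b _ => hb b]
  ring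

/-- **Clause 2.** The transpose of the Robin incidence matrix is the discrete divergence: for a bond
flux `ψ` and contact fluxes `φ`,
`(Bᵀ(ψ,φ))_x = Σ_{b+1<N} ([x = b+1] − [x = b]) ψ_b + [x = 0] φ_0 + [x = N−1] φ_1`. [folklore] -/
theorem robinIncidence_transpose_mulVec (B : Matrix (Fin N ⊕ Fin 2) (Fin N) ℝ)
    (hB : ∀ r x, B r x = Sum.elim
      (fun b : Fin N => if x.val = b.val + 1 then (1 : ℝ) else if x = b ∧ b.val + 1 < N then -1 else 0)
      (fun i : Fin 2 => if (i = 0 ∧ x.val = 0) ∨ (i = 1 ∧ x.val = N - 1) then (1 : ℝ) else 0) r)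
    (ψ : Fin N → ℝ) (φ : Fin 2 → ℝ) (x : Fin N) :
    (Bᵀ *ᵥ Sum.elim ψ φ) x =
      (∑ b : Fin N, if b.val + 1 < N then
        ((if x.val = b.val + 1 then ψ b else 0) - (if x = b then ψ b else 0)) else 0) +
      (if x.val = 0 then φ 0 else 0) + (if x.val = N - 1 then φ 1 else 0) := by
  rw [Matrix.mulVec_apply_eq_sum, Fintype.sum_sum_type, Fin.sum_univ_two]
  simp only [Matrix.transpose_apply, Sum.elim_inl, Sum.elim_inr]
  -- the two contact columns
  have h0r : B (Sum.inr 0) x * φ 0 = if x.val = 0 then φ 0 else 0 := by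
    rw [hB, Sum.elim_inr]
    by_cases hx : x.val = 0
    · rw [if_pos (Or.inl ⟨rfl, hx⟩), if_pos hx, one_mul]
    · rw [if_neg fun h => h.elim (fun h => hx h.2) (fun h => absurd h.1 (by decide)), if_neg hx,
        zero_mul]
  have h1r : B (Sum.inr 1) x * φ 1 = if x.val = N - 1 then φ 1 else 0 := by
    rw [hB, Sum.elim_inr]
    by_cases hx : x.val = N - 1
    · rw [if_pos (Or.inr ⟨rfl, hx⟩), if_pos hx, one_mul]
    · rw [if_neg fun h => h.elim (fun h => absurd h.1 (by decide)) (fun h => hx h.2), if_neg hx,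
        zero_mul]
  -- the bond columns
  have hbd : ∀ b : Fin N, B (Sum.inl b) x * ψ b = if b.val + 1 < N then
      ((if x.val = b.val + 1 then ψ b else 0) - (if x = b then ψ b else 0)) else 0 := by
    intro b
    rw [hB, Sum.elim_inl]
    by_cases hb : b.val + 1 < N
    · rw [if_pos hb]
      by_cases h1 : x.val = b.val + 1
      · have h2 : x ≠ b := by
          rintro rfl
          omega
        rw [if_pos h1, if_pos h1, if_neg h2]
        ring
      · rw [if_neg h1, if_neg h1]
        by_cases h2 : x = b
        · rw [if_pos ⟨h2, hb⟩, if_pos h2]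
          ring
        · rw [if_neg fun h => h2 h.1, if_neg h2]
          ring
    · have hx := x.isLt
      have h1 : ¬ x.val = b.val + 1 := by omega
      rw [if_neg hb, if_neg h1, if_neg fun h => hb h.2]
      ring
  rw [h0r, h1r, Finset.sum_congr rfl fun b _ => hbd b, add_assoc]

/-- **Clause 3.** The squared norm on `Fin N ⊕ Fin 2` of a bond/contact flux vector:
`(ψ,φ)·(ψ,φ) = Σ_b ψ_b² + φ_0² + φ_1²`. [folklore] -/
theorem robinIncidence_sumElim_dotProduct_self (ψ : Fin N → ℝ) (φ : Fin 2 → ℝ) :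
    Sum.elim ψ φ ⬝ᵥ Sum.elim ψ φ = (∑ b, ψ b ^ 2) + φ 0 ^ 2 + φ 1 ^ 2 := by
  rw [dotProduct, Fintype.sum_sum_type, Fin.sum_univ_two]
  simp only [Sum.elim_inl, Sum.elim_inr]
  rw [Finset.sum_congr rfl fun b _ => (sq (ψ b)).symm]
  ring

/-- **The Robin incidence matrix** (stub `stub_robinIncidence` of the LinAlg skeleton of the crux
`RobinCoercivity`). For `N ≥ 2` and the `(Fin N ⊕ Fin 2) × Fin N` matrix `B` whose bond rows
`inl b` are the forward differences `[x = b+1] − [x = b][b+1 < N]` and whose contact rows `inr 0`,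
`inr 1` are the indicators of the sites `0` and `N − 1`:
(1) `|Bξ|²` is the Robin quadratic form of `RobinCoercivity`;
(2) `Bᵀ(ψ,φ)` is the discrete divergence of the bond flux `ψ` and the contact fluxes `φ`;
(3) `|(ψ,φ)|² = Σ_b ψ_b² + φ_0² + φ_1²`. [folklore] -/
theorem stub_robinIncidence {N : ℕ} (hN : 2 ≤ N) (B : Matrix (Fin N ⊕ Fin 2) (Fin N) ℝ)
    (hB : ∀ r x, B r x = Sum.elim
      (fun b : Fin N => if x.val = b.val + 1 then (1 : ℝ) else if x = b ∧ b.val + 1 < N then -1 else 0)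
      (fun i : Fin 2 => if (i = 0 ∧ x.val = 0) ∨ (i = 1 ∧ x.val = N - 1) then (1 : ℝ) else 0) r) :
    (∀ ξ : Fin N → ℝ, (B *ᵥ ξ) ⬝ᵥ (B *ᵥ ξ) =
      ∑ i : Fin N, ((∑ j : Fin N, if j.val = i.val + 1 then (ξ j - ξ i) ^ 2 else 0) +
        (if i.val = 0 then ξ i ^ 2 else 0) + (if i.val = N - 1 then ξ i ^ 2 else 0))) ∧
    (∀ (ψ : Fin N → ℝ) (φ : Fin 2 → ℝ) (x : Fin N), (Bᵀ *ᵥ Sum.elim ψ φ) x =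
      (∑ b : Fin N, if b.val + 1 < N then
        ((if x.val = b.val + 1 then ψ b else 0) - (if x = b then ψ b else 0)) else 0) +
      (if x.val = 0 then φ 0 else 0) + (if x.val = N - 1 then φ 1 else 0)) ∧
    (∀ (ψ : Fin N → ℝ) (φ : Fin 2 → ℝ),
      Sum.elim ψ φ ⬝ᵥ Sum.elim ψ φ = (∑ b, ψ b ^ 2) + φ 0 ^ 2 + φ 1 ^ 2) :=
  ⟨fun ξ => robinIncidence_mulVec_dotProduct_self hN B hB ξ,
    fun ψ φ x => robinIncidence_transpose_mulVec B hB ψ φ x,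
    fun ψ φ => robinIncidence_sumElim_dotProduct_self ψ φ⟩

end Summit.AtomisticToContinuum.FouriersLaw.Theorems.HonestZwanzig.Robin

end
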